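import Summits.QuantumFields.BalabanUV.T4Continuum.Support.NE7TopMismatchLetters
import Summits.QuantumFields.BalabanUV.T4Continuum.Support.NE7EtaRegauging
import Summits.QuantumFields.BalabanUV.T4Continuum.Support.NE7EtaBackgroundCarrier
import Summits.QuantumFields.BalabanUV.T4Continuum.Spine.NE3.SlicePoincareSlicB8Gauge
import Summits.QuantumFields.BalabanUV.T4Continuum.Spine.NE3.CurvedLandauNewtonStep
import Summits.QuantumFields.BalabanUV.T4Continuum.Support.NE3AxialGaugeLadder
import HarnessLib

/-!
# NE7PointedRepModGauge — ROAD (B) KINEMATICS: from ANY Landau representative `U^u = We^{Z}` (row NE3's E′) and ANY extension `c̃` of the corner values of `u`, the POINTED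
# gauge `u′ := c̃⁻¹u` keeps the top of `U` EXACTLY and represents `U^{u′} = (W^{c̃⁻¹})·e^{Ad_{c̃⁻¹}Z}` with `Ad_{c̃⁻¹}Z` EXACTLY (1.38)-Landau relative to the conjugated background
# `W^{c̃⁻¹}` — same orbit, same class, same norms; file 36 (the first brick of memo §7's road (B): no LHCI)

Cell `pub-balaban`, rung (B)+1 sub-cell t4, lineage `b2b-balaban-t4-ne7-p1` (CRUX PROVER NE7 #1 = OWNER of row NE7), generation 78; memo
`t4/b2b-balaban-t4-ne7-p1-g78/BUMP-CLASS-FLAT.md` §5∕§7.  File F105 (composition over the tree's gauge-covariance kinematics: `NE7EtaRegauging.gaugeAct_gaugeAct_eq_vary`,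
`NE7TopMismatchLetters.cavgIter_gaugeAct_eq_of_pinned`, `NE3.SlicePoincareSlicB8Gauge.isLandauB8_of_gaugeAct ∕ dirGauge_inv_dirGauge`, `NE3AxialGaugeLadder.smallField_gaugeAct`,
`NE3.CurvedLandauNewtonStep.isUnitaryCfg_gaugeAct_W`, `NE7EtaBackgroundCarrier.gaugeAct_mul'`, `AveragingDeficitTransport.norm_Ad_of_unitary`).
WHY (memo §5∕§7).  [Balaban1985RegularSpaces] pp. 80–81 replaces the pointed restriction `u(y) = 1` on the coarse points by averaged ones and accepts a top only close to
`V`; the tree's E′ (row NE3, PROVED) is that representative, and its top mismatch `c = u∘M•` is what gen 77 priced at (L1).  Road (B): do NOT pin the Landau representative —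
pin the GAUGE by an explicit smooth extension `c̃` of `c` and carry the resulting finite pure-gauge field through the bookkeeping.  THIS FILE is the exact half of that
move: `u′ := c̃⁻¹u` is pointed (so `U^{u′}` has the top of `U` EXACTLY — same fibre, (L4) with `ω = 0`, (L3) with `κ = 0`, (L1)′ only at second order), and `U^{u′}` is
EXACTLY `W′·e^{Z_L}` with `W′ := W^{c̃⁻¹}` in the SAME ORBIT and the SAME CLASS as `W` and `Z_L := dirGauge c̃⁻¹ Z = Ad_{c̃⁻¹}Z` EXACTLY (1.38)-Landau relative to `W′`, with
`‖Z_L‖ = ‖Z‖` bond by bond.  The perturbative half (`U^{u′} = W·e^{Z′}`, `Z′ = log(W⁻¹W′) + Z_L + O(‖log(W⁻¹W′)‖‖Z‖)`) and the Hessian letter for gauge directions are the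
successor's files (memo §7).
WHAT ([folklore]; 0 def, 0 sorry).  §1 `pointed_of_extension` (unitary, periodic, pointed); §2 **`rep_conjugated_background`** (`U^{u′} = vary (W^{c̃⁻¹}) (dirGauge c̃⁻¹ Z) 1`);
§3 **`isLandauB8_conjugated`**, `smallField_conjugated`, `isUnitaryCfg_conjugated`, `isPeriodicCfg_conjugated`; §4 **`cavgIter_pointed_eq`** (same top); §5 `norm_dirGauge_eq`.
HONEST FRAMING (page 1): gauge-covariance kinematics; nothing analytic; nothing of Bałaban's asserted; (APE) NOT proved; NOT ONE-STEP, NOT NE7; spine 0∕9; finite T⁴ rung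
(B)+1 — NOT infinite volume, NOT mass gap, NOT `BetaPertH`, NOT Clay.  Continuum YM on T⁴ ⇐ BetaPertH ∧ nine spine estimates (0/9 proved); BetaPertH ⇐ (D1) ∧ (D4) ∧
CAP+tail; G-an2-4 gates asym, D1 and NE2/3/4.
-/

set_option autoImplicit false

open scoped BigOperators Matrix Matrix.Norms.L2Operator
open NormedSpace Finset

namespace Summit.QuantumFields.BalabanUV.T4Continuum.NE7PointedRepModGauge

open Literature.MathematicalPhysics.QuantumFieldTheory.Balaban1983to89
open B7Prop1Explicit B7Prop2Explicit
open T4AveragingDeficitWall (Ad IsUnitaryCfg IsSkewDir SmallField vary)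
open T4AveragingDeficitWallBoundary (IsPeriodicCfg)
open AveragingDeficitPeriodicCounting (IsPeriodicDir)
open AveragingDeficitMultiLevelPrep (cavgIter LevelSmall)
open AveragingDeficitTransport (norm_Ad_of_unitary)
open AveragingDeficitLocality (dirGauge)
open NE3EnergyShapes (IsUnitarySite IsPeriodicSite)
open NE3.PairLandauB8 (IsLandauB8)
open NE3.SlicePoincareSlicB8Gauge (isLandauB8_of_gaugeAct dirGauge_inv_dirGauge)
open NE3.CurvedLandauNewtonStep (isUnitaryCfg_gaugeAct_W)
open NE3ResidualSliceRep (isPeriodicCfg_gaugeAct)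
open NE3AxialGaugeLadder (smallField_gaugeAct)
open BlockAveragePushDirGauge (gaugeAct_const_one)
open NE7EtaRegauging (gaugeAct_gaugeAct_eq_vary)
open NE7EtaBackgroundCarrier (gaugeAct_mul')
open NE7TopMismatchLetters (cavgIter_gaugeAct_eq_of_pinned)

noncomputable section

variable {d : ℕ} {n : Type*} [Fintype n] [DecidableEq n]

/-! ## §1 The pointed gauge `u′ := c̃⁻¹·u` -/

/-- **THE POINTED GAUGE**: for unitary periodic `u`, `c̃` with `c̃(M•w) = u(M•w)`, the gauge `u′ := c̃⁻¹u` is unitary, periodic and POINTED (`u′(M•w) = 1`). [folklore] -/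
theorem pointed_of_extension {M : ℕ} {P : ℤ} {u ct : Site d → (Matrix n n ℂ)ˣ} (hu : IsUnitarySite u) (huP : IsPeriodicSite u P)
    (hc : IsUnitarySite ct) (hcP : IsPeriodicSite ct P) (hext : ∀ w : Site d, ct ((M : ℤ) • w) = u ((M : ℤ) • w)) :
    IsUnitarySite (fun y => (ct y)⁻¹ * u y) ∧ IsPeriodicSite (fun y => (ct y)⁻¹ * u y) P ∧ ∀ w : Site d, (fun y => (ct y)⁻¹ * u y) ((M : ℤ) • w) = 1 := by
  refine ⟨fun y => (unitaryUnits _).mul_mem ((unitaryUnits _).inv_mem (hc y)) (hu y), fun y i => ?_, fun w => ?_⟩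
  · simp only [hcP y i, huP y i]
  · simp only [hext w, inv_mul_cancel]

/-! ## §2 The exact representation relative to the conjugated background -/

/-- **`U^{u′} = (W^{c̃⁻¹})·e^{Ad_{c̃⁻¹}Z}` EXACTLY**: if `U^u = vary W Z 1` then `U^{c̃⁻¹u} = vary (W^{c̃⁻¹}) (dirGauge c̃⁻¹ Z) 1`. [folklore] -/
theorem rep_conjugated_background {u ct : Site d → (Matrix n n ℂ)ˣ} {U W : Site d → Fin d → (Matrix n n ℂ)ˣ} {Z : Site d → Fin d → Matrix n n ℂ}
    (hrep : gaugeAct u U = vary W Z 1) :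
    gaugeAct (fun y => (ct y)⁻¹ * u y) U = vary (gaugeAct (fun y => (ct y)⁻¹) W) (dirGauge (fun y => (ct y)⁻¹) Z) 1 := by
  have h := gaugeAct_gaugeAct_eq_vary (fun y => (ct y)⁻¹) u hrep
  exact h

/-! ## §3 The conjugated background is in the same class, and the conjugated field is exactly Landau relative to it -/

/-- `W^{c̃⁻¹}` is unitary. [folklore] -/
theorem isUnitaryCfg_conjugated {ct : Site d → (Matrix n n ℂ)ˣ} (hc : IsUnitarySite ct) {W : Site d → Fin d → (Matrix n n ℂ)ˣ} (hWu : IsUnitaryCfg W) :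
    IsUnitaryCfg (gaugeAct (fun y => (ct y)⁻¹) W) :=
  isUnitaryCfg_gaugeAct_W (fun y => (unitaryUnits _).inv_mem (hc y)) hWu

/-- `W^{c̃⁻¹}` is periodic. [folklore] -/
theorem isPeriodicCfg_conjugated {P : ℤ} {ct : Site d → (Matrix n n ℂ)ˣ} (hcP : IsPeriodicSite ct P) {W : Site d → Fin d → (Matrix n n ℂ)ˣ}
    (hWP : IsPeriodicCfg W P) : IsPeriodicCfg (gaugeAct (fun y => (ct y)⁻¹) W) P :=
  isPeriodicCfg_gaugeAct (fun y i => by simp only [hcP y i]) hWP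

/-- `W^{c̃⁻¹}` has the same plaquette radius (the class is conjugation invariant). [folklore] -/
theorem smallField_conjugated [Nonempty n] {ct : Site d → (Matrix n n ℂ)ˣ} (hc : IsUnitarySite ct) {W : Site d → Fin d → (Matrix n n ℂ)ˣ} {x : ℝ}
    (hWx : SmallField W x) : SmallField (gaugeAct (fun y => (ct y)⁻¹) W) x :=
  smallField_gaugeAct (fun y => (unitaryUnits _).inv_mem (hc y)) hWx

/-- **`Ad_{c̃⁻¹}Z` IS EXACTLY (1.38)-LANDAU RELATIVE TO `W^{c̃⁻¹}`** when `Z` is (1.38)-Landau relative to `W` (multi-level class at `W`, level `j+1`, period `N·L^{j+1}`; `c̃` unitary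
periodic).  Undress `isLandauB8_of_gaugeAct` at the background `W^{c̃⁻¹}` with the gauge `c̃`: `(W^{c̃⁻¹})^{c̃} = W`, `dirGauge c̃ (dirGauge c̃⁻¹ Z) = Z`. [folklore] -/
theorem isLandauB8_conjugated [Nonempty n] {L N : ℕ} (hL : 2 ≤ L) (j : ℕ) {W : Site d → Fin d → (Matrix n n ℂ)ˣ} {x : ℝ}
    (hWu : IsUnitaryCfg W) (hx : 0 ≤ x) (hs : LevelSmall d L j x) (hWx : SmallField W x)
    {ct : Site d → (Matrix n n ℂ)ˣ} (hc : IsUnitarySite ct) (hcP : ∀ (y : Site d) (τ : Fin d), ct (y + ((N * L ^ (j + 1) : ℕ) : ℤ) • e τ) = ct y)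
    {Z : Site d → Fin d → Matrix n n ℂ} (hZ : IsLandauB8 (d := d) L N (j + 1) W Z) :
    IsLandauB8 (d := d) L N (j + 1) (gaugeAct (fun y => (ct y)⁻¹) W) (dirGauge (fun y => (ct y)⁻¹) Z) := by
  have hWu' : IsUnitaryCfg (gaugeAct (fun y => (ct y)⁻¹) W) := isUnitaryCfg_conjugated hc hWu
  have hWx' : SmallField (gaugeAct (fun y => (ct y)⁻¹) W) x := smallField_conjugated hc hWx
  refine isLandauB8_of_gaugeAct hL j hWu' hx hs hWx' (u := ct) hc hcP ?_
  -- `(W^{c̃⁻¹})^{c̃} = W` and `dirGauge c̃ (dirGauge c̃⁻¹ Z) = Z`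
  have h1 : gaugeAct ct (gaugeAct (fun y => (ct y)⁻¹) W) = W := by
    funext x μ
    simp only [gaugeAct, inv_inv, ← mul_assoc, mul_inv_cancel, one_mul, mul_inv_cancel_right]
  rw [h1, dirGauge_inv_dirGauge]
  exact hZ

/-! ## §4 The pointed gauge keeps the top -/

/-- **THE TOP IS KEPT EXACTLY**: `cavgIter L (k+1) (U^{u′}) = cavgIter L (k+1) U` for the pointed gauge `u′ = c̃⁻¹u` (multi-level class at `U`). [folklore] -/
theorem cavgIter_pointed_eq [Nonempty n] {L : ℕ} (hL : 1 ≤ L) (k : ℕ) {U : Site d → Fin d → (Matrix n n ℂ)ˣ} {x : ℝ}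
    (hUu : IsUnitaryCfg U) (hx : 0 ≤ x) (hs : LevelSmall d L k x) (hUx : SmallField U x)
    {u ct : Site d → (Matrix n n ℂ)ˣ} (hu : IsUnitarySite u) (hc : IsUnitarySite ct)
    (hext : ∀ w : Site d, ct (((L : ℤ) ^ (k + 1)) • w) = u (((L : ℤ) ^ (k + 1)) • w)) :
    cavgIter L (k + 1) (gaugeAct (fun y => (ct y)⁻¹ * u y) U) = cavgIter L (k + 1) U :=
  cavgIter_gaugeAct_eq_of_pinned hL k hUu hx hs hUx rfl (fun y => (unitaryUnits _).mul_mem ((unitaryUnits _).inv_mem (hc y)) (hu y))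
    (fun z => by simp only [hext z, inv_mul_cancel])

/-! ## §5 Norms -/

/-- The conjugated field has the same bond norms: `‖(dirGauge c̃⁻¹ Z)(y, μ)‖ = ‖Z(y, μ)‖`. [folklore] -/
theorem norm_dirGauge_eq {ct : Site d → (Matrix n n ℂ)ˣ} (hc : IsUnitarySite ct) (Z : Site d → Fin d → Matrix n n ℂ) (y : Site d) (μ : Fin d) :
    ‖dirGauge (fun y => (ct y)⁻¹) Z y μ‖ = ‖Z y μ‖ := by
  simp only [dirGauge]
  exact norm_Ad_of_unitary ((unitaryUnits _).inv_mem (hc _)) _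

/-- The pointed gauge is close to `1` when `u` and `c̃` are: `‖u′(y) − 1‖ ≤ ‖c̃(y)⁻¹ − 1‖·(1 + ‖u(y) − 1‖) + ‖u(y) − 1‖`. [folklore] -/
theorem norm_pointed_sub_one_le [Nonempty n] {u ct : Site d → (Matrix n n ℂ)ˣ} (y : Site d) :
    ‖(((fun y => (ct y)⁻¹ * u y) y : (Matrix n n ℂ)ˣ) : Matrix n n ℂ) - 1‖
      ≤ ‖(((ct y)⁻¹ : (Matrix n n ℂ)ˣ) : Matrix n n ℂ) - 1‖ * (1 + ‖((u y : (Matrix n n ℂ)ˣ) : Matrix n n ℂ) - 1‖) + ‖((u y : (Matrix n n ℂ)ˣ) : Matrix n n ℂ) - 1‖ := by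
  set A : Matrix n n ℂ := (((ct y)⁻¹ : (Matrix n n ℂ)ˣ) : Matrix n n ℂ) with hA
  set B : Matrix n n ℂ := ((u y : (Matrix n n ℂ)ˣ) : Matrix n n ℂ) with hB
  have e1 : (((fun y => (ct y)⁻¹ * u y) y : (Matrix n n ℂ)ˣ) : Matrix n n ℂ) - 1 = (A - 1) * B + (B - 1) := by
    simp only [Units.val_mul, ← hA, ← hB]; noncomm_ring
  rw [e1]
  calc ‖(A - 1) * B + (B - 1)‖ ≤ ‖(A - 1) * B‖ + ‖B - 1‖ := norm_add_le _ _
    _ ≤ ‖A - 1‖ * ‖B‖ + ‖B - 1‖ := by gcongr; exact norm_mul_le _ _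
    _ ≤ ‖A - 1‖ * (1 + ‖B - 1‖) + ‖B - 1‖ := by
        have hB1 : ‖B‖ ≤ 1 + ‖B - 1‖ := by
          calc ‖B‖ = ‖(1 : Matrix n n ℂ) + (B - 1)‖ := by rw [add_sub_cancel]
            _ ≤ ‖(1 : Matrix n n ℂ)‖ + ‖B - 1‖ := norm_add_le _ _
            _ = 1 + ‖B - 1‖ := by rw [norm_one]
        gcongr

end

end Summit.QuantumFields.BalabanUV.T4Continuum.NE7PointedRepModGauge
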